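import Literature.NumberTheory.GaloisCohomology.Howard2004.DVRSettingPiRefinementSelmer
import Literature.NumberTheory.GaloisCohomology.Howard2004.ResidualDualityDatumProofs
import Literature.NumberTheory.GaloisCohomology.Howard2004.LevelQuotientProofs
import Literature.NumberTheory.GaloisCohomology.Howard2004.KolyvaginSystemReindex
import Literature.NumberTheory.GaloisCohomology.Howard2004.TowerMorphismPushforward
import Literature.NumberTheory.GaloisCohomology.Howard2004.SelmerAtPresentationProofs
import HarnessLib

/-!
# The π-adic refinement of a `DVRSetting`: tower-level facts — `𝓛₀(T♯) = 𝓛₀(T)`, `𝓛_s(T♯) = 𝓛_s(T)`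
# (`LargePrimes`) and the bottom class `κ♯_1` (theorems + one definition with body)

Topic `NumberTheory/GaloisCohomology/Howard2004`. No named fact, no instance, no notation, no `sorry`; ONE
definition with body (`DVRSetting.refinedFamily`, the explicit formula for `κ♯_1`), theorems otherwise. Cell
`pub/bsd-print-x9`, print leaf G87 `Literature.NumberTheory.GaloisCohomology.Howard2004.thm161_dvrKolyvaginBound`
(Howard Thm. 1.6.1); seat `bsd-line-x10b-p1` LEAD g12, brick «R7-TOWER♯» of the π-adic REFINEMENT programme
(x10b-p1-w2 g16's `DVRSetting.piRefinementDatum` / `DVRSetting.refinedTower`, `DVRSettingPiRefinement.lean`):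
the facts about the refined setting that live at the level of the TOWER `i ↦ T/π^{i+1}T` alone (no level rings,
no Selmer triples, no level data).

SOURCE. B. Howard, *The Heegner point Kolyvagin system*, Compositio Math. **140** (2004) = arXiv:1202.6340:
§1.2 `𝓛₀(T)`, Def. 1.2.1 `𝓛_s(T)` (p. 6 L54–68); §1.3 H.2 and Remark 1.3.1 «H.0–H.5 are stable under base
change» (p. 7 L61–63, L125–127); §1.6 «`R^{(k)} = R/𝔪^k`, `T^{(k)} = T/𝔪^kT`», «suppose `𝓛_s(T) ⊂ 𝓛` for
`s ≫ 0` … a Kolyvagin system `κ` with `κ_1 ≠ 0`», `H¹_F(K,T) = lim` (p. 11 L13–36, p. 12 L29–33).  The tree's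
`DVRSetting` carries `T` as a tower with exponents `e_k` (D1's Eisenstein frames: `e_k = m(k+1)`); Howard's
proof runs on the FULL tower (w7 g7 «LEVEL-GAP»), whence the refinement `T♯`, `T♯_i = T/π^{i+1}T`
(x10b-p1 LEAD g11 (β); LEAD g12 rulings 2026-08-29).

WHAT IS PROVED (for `S : DVRSetting …`, `hy : S.SatisfiesH`; `T♯ := S.refinedTower hy`, `D := S.piRefinementDatum hy`).
* §1 generic: `isUnramifiedAt_of_injective`, `degreeTwoPrimes_subset_of_injective`, `sub_mem_smul_top_of_injective`,
  `comap_smul_top_le_of_ker_le` (unramifiedness / the Frobenius clause along an injective equivariant map),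
  `IsQuotientBy.cohomologyMap_mem_selmerGroup_propagateStructure` (Selmer ⇒ Selmer for the propagated structure,
  no hypothesis on the kernel), `AdicTower.cohomologyMap_redLE_apply_of_mem_limitH1` (`H¹(redLE)(x_{k'}) = x_k`).
* §2 **`degreeTwoPrimes_refinedTower : T♯.degreeTwoPrimes p = S.T.degreeTwoPrimes p`** (⊆ along the
  bijections `T^{(k)} ≅ T/π^{e_k}T` = `proj_bijective_of_eq_e`; ⊇ is x10b-p1-w2 g16's
  `degreeTwoPrimes_subset_refinedTower`, `DVRSettingPiRefinementSelmer`),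
  `L_subset_degreeTwoPrimes_refinedTower` (T5 / `SatisfiesH.L_subset` for the refined setting).
* §3 **`kolyvaginPrimes_refinedTower : T♯.kolyvaginPrimes p s = S.T.kolyvaginPrimes p s`** (⊇ is w2 g16's
  `kolyvaginPrimes_subset_refinedTower`), **`largePrimes_refinedTower_iff`**
  (`(∃ s₀, ∀ s ≥ s₀, 𝓛_s(T♯) ⊆ 𝓛) ↔ S.LargePrimes`).  (H.2 for `T♯` is w2 g16's `h2Tower_refinedTower`.)
* §4 `refinedFamily S hy x : ∀ i, H¹(K, T♯_i)` := `H¹(proj)(x_{host(i+1)})` and, for `x ∈ lim_k H¹(K, T^{(k)})`: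
  `projH1_apply_of_mem_limitH1` (host independence), **`refinedFamily_mem_limitH1`**, `refinedFamily_mem_selmerGroup`
  / **`refinedFamily_mem_limitSelmer`** (for w2 g16's `refinedCond` / `refinedTriple`, the propagated local
  conditions of the refined triples), `refinedFamily_apply_of_eq_e` (the (COFINAL) letter
  `one♯ (σ k) = H¹(ι_k)(one k)` at `i + 1 = e_k`), **`eq_zero_of_refinedFamily_eq_zero`** (`κ_1 ≠ 0 ⇒ κ♯_1 ≠ 0`).

HONEST FRAMING. Plumbing for the refined setting's `SatisfiesH.L_subset`, its `LargePrimes` and the bottom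
class of its Kolyvagin system; the refined LEVEL DATA, the pushforward of `κ_n` and `κ_one♯` are NOT here (R5–R7
of the programme). `thm161_dvrKolyvaginBound` is NOT proved; no summit statement is proved; the
Birch–Swinnerton-Dyer conjecture is not proved by any of this.
References: [Howard2004HeegnerKolyvagin] §1.2, Def. 1.2.1, §1.3 H.2, Remark 1.3.1, §1.6 / Thm. 1.6.1;
[SerreGaloisCohomology1997] I §2.2 (functoriality of `H¹`).
-/

set_option autoImplicit false

noncomputable section

open Function NumberField IsDedekindDomain Field
open scoped NumberField

namespace Literature.NumberTheory.GaloisCohomology.Howard2004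

open Literature.NumberTheory.GaloisRepresentations
open Literature.NumberTheory.GaloisRepresentations.DiscreteGaloisModule

/-! ## §1 Generic: unramifiedness and the Frobenius clause along an injective equivariant map;
two-index reductions on `H¹`; Selmer classes map to Selmer classes of the propagated structure -/

section Generic

variable {K : Type} [Field K] [NumberField K]
  {M : Type} [AddCommGroup M] [TopologicalSpace M] [DiscreteTopology M]
  {M' : Type} [AddCommGroup M'] [TopologicalSpace M'] [DiscreteTopology M']
  {R : Type} [CommRing R] [Module R M] [Module R M']

omit [NumberField K] in
/-- `T'` unramified at `v` and `f : T → T'` injective equivariant ⇒ `T` unramified at `v`.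
[cite: Howard2004HeegnerKolyvagin, §1.2 (arXiv p. 6, L54–60: 𝓛₀(T))] -/
theorem isUnramifiedAt_of_injective (ρ : DiscreteGaloisModule K M) (ρ' : DiscreteGaloisModule K M')
    (f : M →ₗ[R] M') (hf : ∀ (g : absoluteGaloisGroup K) (x : M), f (ρ g x) = ρ' g (f x))
    (hinj : Injective f) {v : HeightOneSpectrum (𝓞 K)} (hur : GaloisRep.IsUnramifiedAt v ρ') :
    GaloisRep.IsUnramifiedAt v ρ := by
  intro 𝔓 h𝔓 σ hσ
  have h1 : ρ' σ = 1 := hur 𝔓 h𝔓 σ hσ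
  ext x
  apply hinj
  rw [hf, h1]
  rfl

omit [NumberField K] in
/-- `𝓛₀(T') ⊆ 𝓛₀(T)` along an injective equivariant `f : T → T'`.
[cite: Howard2004HeegnerKolyvagin, §1.2 (arXiv p. 6, L54–60)] -/
theorem degreeTwoPrimes_subset_of_injective (p : ℕ) (ρ : DiscreteGaloisModule K M)
    (ρ' : DiscreteGaloisModule K M') (f : M →ₗ[R] M')
    (hf : ∀ (g : absoluteGaloisGroup K) (x : M), f (ρ g x) = ρ' g (f x)) (hinj : Injective f) :
    degreeTwoPrimes p ρ' ⊆ degreeTwoPrimes p ρ :=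
  fun _ hv => ⟨hv.1, hv.2.1, isUnramifiedAt_of_injective ρ ρ' f hf hinj hv.2.2⟩

omit [NumberField K] in
/-- The Frobenius clause of `𝓛_s` pulls back along an injective equivariant `f : T → T'`:
`ρ' σ (f x) - f x ∈ J·T'` ⇒ `ρ σ x - x ∈ J·T` when moreover `f⁻¹(J·T') ⊆ J·T` (e.g. `f` bijective).
[cite: Howard2004HeegnerKolyvagin, Def. 1.2.1 (arXiv p. 6, L63–68)] -/
theorem sub_mem_smul_top_of_injective (ρ : DiscreteGaloisModule K M) (ρ' : DiscreteGaloisModule K M')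
    (f : M →ₗ[R] M') (hf : ∀ (g : absoluteGaloisGroup K) (x : M), f (ρ g x) = ρ' g (f x))
    (J : Ideal R) (hJ : (J • (⊤ : Submodule R M')).comap f ≤ J • (⊤ : Submodule R M))
    (σ : absoluteGaloisGroup K) (x : M) (h : ρ' σ (f x) - f x ∈ J • (⊤ : Submodule R M')) :
    ρ σ x - x ∈ J • (⊤ : Submodule R M) := by
  refine hJ ?_
  rw [Submodule.mem_comap, map_sub, hf]
  exact h

omit [NumberField K] [TopologicalSpace M] [DiscreteTopology M] [TopologicalSpace M'] [DiscreteTopology M'] in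
/-- For a SURJECTIVE `R`-linear `f`, `f⁻¹(J·T') = J·T + ker f`; so `f⁻¹(J·T') ⊆ J·T` once `ker f ⊆ J·T`.
[cite: Howard2004HeegnerKolyvagin, Def. 1.1.3 (arXiv p. 5, L93–99)] -/
theorem comap_smul_top_le_of_ker_le (f : M →ₗ[R] M') (hsurj : Surjective f) (J : Ideal R)
    (hker : LinearMap.ker f ≤ J • (⊤ : Submodule R M)) :
    (J • (⊤ : Submodule R M')).comap f ≤ J • (⊤ : Submodule R M) := by
  have hmap : (J • (⊤ : Submodule R M)).map f = J • (⊤ : Submodule R M') := by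
    rw [Submodule.map_smul'', Submodule.map_top, LinearMap.range_eq_top.mpr hsurj]
  rw [← hmap, Submodule.comap_map_eq]
  exact sup_le le_rfl hker

/-- `H¹(π) x` is Selmer for the PROPAGATED structure whenever `x` is Selmer (no hypothesis on `ker π`).
[cite: Howard2004HeegnerKolyvagin, Def. 1.1.3 and Def. 1.1.10 (arXiv pp. 5–6)] -/
theorem IsQuotientBy.cohomologyMap_mem_selmerGroup_propagateStructure {N : Type} [AddCommGroup N]
    [TopologicalSpace N] [DiscreteTopology N] [Module R N] {ρ : DiscreteGaloisModule K M} {I : Ideal R}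
    {ρI : DiscreteGaloisModule K N} {π : M →ₗ[R] N} (h : IsQuotientBy ρ I ρI π)
    (𝓕 : SelmerStructure ρ) {x : galoisCohomology ρ 1} (hx : x ∈ 𝓕.selmerGroup) :
    h.cohomologyMap 1 x ∈ (h.propagateStructure 𝓕).selmerGroup := by
  simp only [SelmerStructure.mem_selmerGroup_iff, IsQuotientBy.propagateStructure_apply,
    h.localization_cohomologyMap] at hx ⊢
  exact fun v => ⟨_, hx v, rfl⟩

end Generic

namespace AdicTower

variable {K : Type} [Field K] [NumberField K] {R : Type} [CommRing R] [IsLocalRing R]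
  {N : ℕ → Type} [∀ k, AddCommGroup (N k)] [∀ k, TopologicalSpace (N k)]
  [∀ k, DiscreteTopology (N k)] [∀ k, Module R (N k)]

omit [NumberField K] in
/-- A family in `lim_k H¹(K, T_k)` is compatible under the TWO-INDEX reductions `redLE`:
`H¹(redLE) (x k') = x k` for `k ≤ k'`. [cite: Howard2004HeegnerKolyvagin, §1.6 (arXiv p. 12, L29–33)] -/
theorem cohomologyMap_redLE_apply_of_mem_limitH1 (T : AdicTower K R N) {x : ∀ k, galoisCohomology (T.ρ k) 1}
    (hx : x ∈ T.limitH1) {k k' : ℕ} (h : k ≤ k') :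
    ContinuousRep.cohomologyMap (T.ρ k') (T.ρ k) (T.redLE h).toAddMonoidHom continuous_of_discreteTopology
      (T.redLE_equivariant h) 1 (x k') = x k := by
  induction k', h using Nat.le_induction with
  | base => exact cohomologyMap_one_id_apply (T.ρ k) _ (T.redLE_equivariant le_rfl) (T.redLE_self k) (x k)
  | succ k' h ih =>
    rw [← cohomologyMap_one_comp_eq (T.ρ (k' + 1)) (T.ρ k') (T.ρ k) (T.red k').toAddMonoidHom
      (T.red_equivariant k') (T.redLE h).toAddMonoidHom (T.redLE_equivariant h)
      (T.redLE (Nat.le_succ_of_le h)).toAddMonoidHom (T.redLE_equivariant _)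
      (fun y => (T.redLE_succ h y).symm) (x (k' + 1))]
    change ContinuousRep.cohomologyMap (T.ρ k') (T.ρ k) (T.redLE h).toAddMonoidHom continuous_of_discreteTopology
      (T.redLE_equivariant h) 1 (T.redH1 k' (x (k' + 1))) = x k
    rw [show T.redH1 k' (x (k' + 1)) = x k' from hx k', ih]

end AdicTower

namespace DVRSetting

variable {p : ℕ} [Fact p.Prime] {K : Type} [Field K] [NumberField K]
  {R : Type} [CommRing R] [IsDomain R] [IsDiscreteValuationRing R] [Algebra ℤ_[p] R]
  {N : ℕ → Type} [∀ k, AddCommGroup (N k)] [∀ k, TopologicalSpace (N k)]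
  [∀ k, DiscreteTopology (N k)] [∀ k, Module R (N k)]
  {Rk : ℕ → Type} [∀ k, CommRing (Rk k)] [∀ k, IsLocalRing (Rk k)] [∀ k, TopologicalSpace (Rk k)]
  [∀ k, DiscreteTopology (Rk k)] [∀ k, Algebra ℤ_[p] (Rk k)] [∀ k, Algebra R (Rk k)]
  [∀ k, Module (Rk k) (N k)] [∀ k, IsScalarTower R (Rk k) (N k)]
  {Nbar : Type} [AddCommGroup Nbar] [TopologicalSpace Nbar] [DiscreteTopology Nbar]
  [∀ k, Module (Rk k) Nbar]
  {Nq : ℕ → Finset (HeightOneSpectrum (𝓞 K)) → Type} [∀ k n, AddCommGroup (Nq k n)]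
  [∀ k n, TopologicalSpace (Nq k n)] [∀ k n, DiscreteTopology (Nq k n)]
  [∀ k n, Module (Rk k) (Nq k n)] [∀ k n, Module R (Nq k n)]
  [∀ k n, IsScalarTower R (Rk k) (Nq k n)]

/-! ## §2 `𝓛₀(T♯) = 𝓛₀(T)` -/

/-- Every level `T^{(k)}` maps INJECTIVELY (indeed bijectively) and equivariantly onto the refined level of
exponent `e_k`. [cite: Howard2004HeegnerKolyvagin, §1.6 (arXiv p. 11 L33–36, p. 12 L29–55)] -/
theorem proj_injective_e (S : DVRSetting p K R N Rk Nbar Nq) (hy : S.SatisfiesH) (k : ℕ) :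
    Injective ((S.piRefinementDatum hy).proj (S.host_le_of_eq_e hy (rfl : S.e k = S.e k))) :=
  (S.proj_bijective_of_eq_e hy rfl).1

/-- Every refined level `T/π^iT` (`1 ≤ i`) is unramified wherever every `T^{(k)}` is, and conversely:
**`𝓛₀(T♯) = 𝓛₀(T)`**. [cite: Howard2004HeegnerKolyvagin, §1.2 and §1.6 (arXiv p. 6 L54–60, p. 12 L29–55)] -/
theorem degreeTwoPrimes_refinedTower (S : DVRSetting p K R N Rk Nbar Nq) (hy : S.SatisfiesH) :
    (S.refinedTower hy).degreeTwoPrimes p = S.T.degreeTwoPrimes p := by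
  ext v
  simp only [AdicTower.degreeTwoPrimes, Set.mem_iInter]
  constructor
  · intro hv k
    -- `T^{(k)} ↪ Level (e_k) = level (e_k - 1) of the refined tower`
    obtain ⟨j, hj⟩ : ∃ j, S.e k = j + 1 := ⟨S.e k - 1, (Nat.sub_add_cancel (S.one_le_e hy k)).symm⟩
    have hk : (S.piRefinementDatum hy).host (j + 1) ≤ k := S.host_le_of_eq_e hy hj.symm
    exact degreeTwoPrimes_subset_of_injective p (S.T.ρ k) ((S.piRefinementDatum hy).levelRep (j + 1))
      ((S.piRefinementDatum hy).proj hk) (fun g x => S.proj_equivariant hy hk g x)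
      (S.proj_bijective_of_eq_e hy hj.symm).1 (hv j)
  · intro hv
    have h := S.degreeTwoPrimes_subset_refinedTower hy (Set.mem_iInter.mpr hv)
    simpa only [AdicTower.degreeTwoPrimes, Set.mem_iInter] using h

/-- **T5 for the refined setting**: `𝓛 ⊆ 𝓛₀(T♯)` (the clause `SatisfiesH.L_subset`).
[cite: Howard2004HeegnerKolyvagin, §1.2 and §1.6 (arXiv p. 6 L97–99, p. 11 L15–16)] -/
theorem L_subset_degreeTwoPrimes_refinedTower (S : DVRSetting p K R N Rk Nbar Nq) (hy : S.SatisfiesH) :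
    S.L ⊆ (S.refinedTower hy).degreeTwoPrimes p := by
  rw [S.degreeTwoPrimes_refinedTower hy]
  exact hy.L_subset

/-! ## §3 `𝓛_s(T♯) = 𝓛_s(T)` and `LargePrimes` -/

/-- **`𝓛_s(T♯) = 𝓛_s(T)`**: the Frobenius clause «`Frob_λ ≡ 1` on every level modulo `p^s`» passes to the
quotients `T/π^iT` of the `T^{(k)}` and back along the bijections `T^{(k)} ≅ T/π^{e_k}T`.
[cite: Howard2004HeegnerKolyvagin, Def. 1.2.1 and §1.6 (arXiv p. 6 L63–68, p. 12 L29–55)] -/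
theorem kolyvaginPrimes_refinedTower (S : DVRSetting p K R N Rk Nbar Nq) (hy : S.SatisfiesH) (s : ℕ) :
    (S.refinedTower hy).kolyvaginPrimes p s = S.T.kolyvaginPrimes p s := by
  refine Set.Subset.antisymm ?_ (S.kolyvaginPrimes_subset_refinedTower hy s)
  rintro v ⟨h0, h1, h⟩
  refine ⟨(S.degreeTwoPrimes_refinedTower hy).le h0, h1, fun k σ hσ x => ?_⟩
  obtain ⟨j, hj⟩ : ∃ j, S.e k = j + 1 := ⟨S.e k - 1, (Nat.sub_add_cancel (S.one_le_e hy k)).symm⟩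
  have hk : (S.piRefinementDatum hy).host (j + 1) ≤ k := S.host_le_of_eq_e hy hj.symm
  refine sub_mem_smul_top_of_injective (S.T.ρ k) ((S.piRefinementDatum hy).levelRep (j + 1))
    ((S.piRefinementDatum hy).proj hk) (fun g y => S.proj_equivariant hy hk g y) _
    (comap_smul_top_le_of_ker_le _ ((S.piRefinementDatum hy).proj_surjective hk) _ ?_) σ x (h j σ hσ _)
  rw [LinearMap.ker_eq_bot.mpr (S.proj_bijective_of_eq_e hy hj.symm).1]
  exact bot_le

/-- **`LargePrimes` is the same for the refined setting**: «`𝓛_s(T♯) ⊂ 𝓛` for `s ≫ 0`» iff the same for `T`.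
[cite: Howard2004HeegnerKolyvagin, §1.6 (arXiv p. 11, L15–16)] -/
theorem largePrimes_refinedTower_iff (S : DVRSetting p K R N Rk Nbar Nq) (hy : S.SatisfiesH) :
    (∃ s₀ : ℕ, ∀ s, s₀ ≤ s → (S.refinedTower hy).kolyvaginPrimes p s ⊆ S.L) ↔ S.LargePrimes := by
  simp only [DVRSetting.LargePrimes, S.kolyvaginPrimes_refinedTower hy]

/-! ## §4 The bottom class: a compatible family of `T` read on the refined tower -/

/-- **A family `(x_k)_k ∈ Π_k H¹(K, T^{(k)})` read on the refined tower**: at the refined level `i` (exponent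
`i+1`, hosted on `k = host (i+1)`) the class `H¹(proj)(x_k) ∈ H¹(K, T/π^{i+1}T)`.  For `x = κ_1 ∈ lim_k H¹(K,T^{(k)})`
this is the bottom class `κ♯_1` of the refined Kolyvagin system.
[cite: Howard2004HeegnerKolyvagin, §1.6 (arXiv p. 11 L23–24, p. 12 L29–33: `κ_1 ∈ H¹_F(K,T) = lim`)] -/
def refinedFamily (S : DVRSetting p K R N Rk Nbar Nq) (hy : S.SatisfiesH)
    (x : ∀ k, galoisCohomology (S.T.ρ k) 1) : ∀ i, galoisCohomology ((S.refinedTower hy).ρ i) 1 :=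
  fun i => ((S.piRefinementDatum hy).isQuotientBy_levelRep
    (le_refl ((S.piRefinementDatum hy).host (i + 1)))).cohomologyMap 1 (x ((S.piRefinementDatum hy).host (i + 1)))

/-- Unfolding `refinedFamily`. [cite: Howard2004HeegnerKolyvagin, §1.6 (arXiv p. 12, L29–33)] -/
theorem refinedFamily_apply (S : DVRSetting p K R N Rk Nbar Nq) (hy : S.SatisfiesH)
    (x : ∀ k, galoisCohomology (S.T.ρ k) 1) (i : ℕ) :
    S.refinedFamily hy x i = ((S.piRefinementDatum hy).isQuotientBy_levelRep
      (le_refl ((S.piRefinementDatum hy).host (i + 1)))).cohomologyMap 1 (x ((S.piRefinementDatum hy).host (i + 1))) :=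
  rfl

/-- **Host independence**: for a COMPATIBLE family, `H¹(proj_k)(x_k) ∈ H¹(K, T/π^iT)` does not depend on the
level `k ≥ host i` it is read from. [cite: Howard2004HeegnerKolyvagin, §1.6 (arXiv p. 12, L29–33)] -/
theorem projH1_apply_of_mem_limitH1 (S : DVRSetting p K R N Rk Nbar Nq) (hy : S.SatisfiesH)
    {x : ∀ k, galoisCohomology (S.T.ρ k) 1} (hx : x ∈ S.T.limitH1) {i k : ℕ}
    (h : (S.piRefinementDatum hy).host i ≤ k) :
    ((S.piRefinementDatum hy).isQuotientBy_levelRep h).cohomologyMap 1 (x k) =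
      ((S.piRefinementDatum hy).isQuotientBy_levelRep le_rfl).cohomologyMap 1
        (x ((S.piRefinementDatum hy).host i)) := by
  rw [← S.T.cohomologyMap_redLE_apply_of_mem_limitH1 hx h]
  exact (cohomologyMap_one_comp_eq (S.T.ρ k) (S.T.ρ ((S.piRefinementDatum hy).host i))
    ((S.piRefinementDatum hy).levelRep i) (S.T.redLE h).toAddMonoidHom (S.T.redLE_equivariant h)
    ((S.piRefinementDatum hy).proj le_rfl).toAddMonoidHom
    ((S.piRefinementDatum hy).isQuotientBy_levelRep le_rfl).equivariant
    ((S.piRefinementDatum hy).proj h).toAddMonoidHom ((S.piRefinementDatum hy).isQuotientBy_levelRep h).equivariant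
    (fun y => (S.piRefinementDatum hy).proj_red le_rfl h y) (x k)).symm

/-- **The refined family of a compatible family is compatible**: `refinedFamily x ∈ lim_i H¹(K, T/π^{i+1}T)`.
[cite: Howard2004HeegnerKolyvagin, §1.6 (arXiv p. 12, L29–33)] -/
theorem refinedFamily_mem_limitH1 (S : DVRSetting p K R N Rk Nbar Nq) (hy : S.SatisfiesH)
    {x : ∀ k, galoisCohomology (S.T.ρ k) 1} (hx : x ∈ S.T.limitH1) :
    S.refinedFamily hy x ∈ (S.refinedTower hy).limitH1 := by
  intro i
  have hmono : (S.piRefinementDatum hy).host (i + 1) ≤ (S.piRefinementDatum hy).host (i + 1 + 1) :=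
    (S.piRefinementDatum hy).host_mono (Nat.le_succ _)
  rw [refinedFamily_apply, refinedFamily_apply, ← S.projH1_apply_of_mem_limitH1 hy hx hmono]
  refine cohomologyMap_one_comp_eq (S.T.ρ ((S.piRefinementDatum hy).host (i + 1 + 1)))
    ((S.piRefinementDatum hy).levelRep (i + 1 + 1)) ((S.piRefinementDatum hy).levelRep (i + 1))
    ((S.piRefinementDatum hy).proj le_rfl).toAddMonoidHom
    ((S.piRefinementDatum hy).isQuotientBy_levelRep le_rfl).equivariant
    ((S.refinedTower hy).red i).toAddMonoidHom ((S.refinedTower hy).red_equivariant i)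
    ((S.piRefinementDatum hy).proj hmono).toAddMonoidHom ((S.piRefinementDatum hy).isQuotientBy_levelRep hmono).equivariant
    (fun y => ?_) _
  change (S.piRefinementDatum hy).map (i + 1 + 1) (i + 1) ((S.piRefinementDatum hy).proj le_rfl y) =
    (S.piRefinementDatum hy).proj hmono y
  rw [(S.piRefinementDatum hy).map_proj (i + 1 + 1) (i + 1) le_rfl hmono, show i + 1 - (i + 1 + 1) = 0 by omega,
    pow_zero, one_smul]

/-- **Selmer**: each component of the refined family lies in the Selmer group of the PROPAGATED structure
(the local conditions of the refined triple at exponent `i+1`) as soon as `x_k` is Selmer at the host level.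
[cite: Howard2004HeegnerKolyvagin, Def. 1.1.3 / 1.1.10 and §1.6 (arXiv pp. 5–6, p. 12 L29–33)] -/
theorem refinedFamily_mem_selmerGroup (S : DVRSetting p K R N Rk Nbar Nq) (hy : S.SatisfiesH)
    {x : ∀ k, galoisCohomology (S.T.ρ k) 1} (hx : ∀ k, x k ∈ ((S.t k).cond).selmerGroup) (i : ℕ) :
    S.refinedFamily hy x i ∈ (S.refinedCond hy (i + 1)).selmerGroup :=
  IsQuotientBy.cohomologyMap_mem_selmerGroup_propagateStructure _ _ (hx _)

/-- The refined family of a family in `lim_k H¹_{F_k}(K, T^{(k)})` lies in the limit Selmer group of the refined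
tower for the propagated structures. [cite: Howard2004HeegnerKolyvagin, Def. 1.1.10 and §1.6 (arXiv p. 6, p. 12 L29–33)] -/
theorem refinedFamily_mem_limitSelmer (S : DVRSetting p K R N Rk Nbar Nq) (hy : S.SatisfiesH)
    {x : ∀ k, galoisCohomology (S.T.ρ k) 1} (hx : x ∈ S.T.limitSelmer fun k => (S.t k).cond) :
    S.refinedFamily hy x ∈ (S.refinedTower hy).limitSelmer fun i => (S.refinedTriple hy (i + 1)).cond := by
  rw [AdicTower.mem_limitSelmer_iff] at hx ⊢
  exact ⟨S.refinedFamily_mem_limitH1 hy hx.1, fun i => S.refinedFamily_mem_selmerGroup hy hx.2 i⟩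

/-- **The marked levels**: at a refined index `i` with `i + 1 = e_k` the refined family IS `H¹(proj)(x_k)` read from
`T^{(k)}` itself (the (COFINAL) letter `one′ (σ k) = H¹(ι_k)(one k)`).
[cite: Howard2004HeegnerKolyvagin, §1.6 (arXiv p. 11 L33–36, p. 12 L29–33)] -/
theorem refinedFamily_apply_of_eq_e (S : DVRSetting p K R N Rk Nbar Nq) (hy : S.SatisfiesH)
    {x : ∀ k, galoisCohomology (S.T.ρ k) 1} (hx : x ∈ S.T.limitH1) {i k : ℕ} (hi : i + 1 = S.e k) :
    S.refinedFamily hy x i =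
      ((S.piRefinementDatum hy).isQuotientBy_levelRep (S.host_le_of_eq_e hy hi)).cohomologyMap 1 (x k) := by
  rw [refinedFamily_apply, S.projH1_apply_of_mem_limitH1 hy hx (S.host_le_of_eq_e hy hi)]

/-- **`κ_1 ≠ 0 ⇒ κ♯_1 ≠ 0`**: a compatible family whose refined family vanishes is zero — `x_k` is read,
through the BIJECTION `T^{(k)} ≅ T/π^{e_k}T`, at the refined index `e_k - 1`.
[cite: Howard2004HeegnerKolyvagin, Thm. 1.6.1 hypothesis `κ_1 ≠ 0` and §1.6 (arXiv p. 11 L23–26, p. 12 L29–33)] -/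
theorem eq_zero_of_refinedFamily_eq_zero (S : DVRSetting p K R N Rk Nbar Nq) (hy : S.SatisfiesH)
    {x : ∀ k, galoisCohomology (S.T.ρ k) 1} (hx : x ∈ S.T.limitH1) (h0 : S.refinedFamily hy x = 0) :
    x = 0 := by
  funext k
  have hi : S.e k - 1 + 1 = S.e k := Nat.sub_add_cancel (S.one_le_e hy k)
  have h1 := S.refinedFamily_apply_of_eq_e hy hx hi
  rw [h0, Pi.zero_apply] at h1
  have hker : LinearMap.ker ((S.piRefinementDatum hy).proj (S.host_le_of_eq_e hy hi)) = ⊥ :=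
    LinearMap.ker_eq_bot.mpr (S.proj_bijective_of_eq_e hy hi).1
  have hinj := (((S.piRefinementDatum hy).isQuotientBy_levelRep
    (S.host_le_of_eq_e hy hi)).bijective_cohomologyMap_of_ker_eq_bot hker).1
  exact hinj (h1.symm.trans (map_zero _).symm)

end DVRSetting

end Literature.NumberTheory.GaloisCohomology.Howard2004

end
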